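import Literature.Claims.NS.PanPan2025
import HarnessLib

/-!
# C97 `PanPan2025` (#103) — ERRATUM-COLUMN kernel refutation of `Step_C1bAbs` (the Grönwall step p.27 d11 – p.28 l.4)

`Literature.Claims.NS.PanPan2025.Step_C1bAbs` types, at the grain the print invokes it (cell rule F15), the
step p.28 l.1–4 «By standard Gronwall's inequality (cf. Evans, 2010, Appendix B) and the initial condition
y(0) = ‖∇u₀‖²_{L²}, it follows that y(t) + ν∫₀ᵗ‖Δu(s)‖²ds ≤ C» applied to a differential inequality of the
form `y′ ≤ a + b·y + c·y²` (p.27 d11 after the interpolation p.28 l.2): for all `a, b, c ≥ 0`, `T > 0`,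
`y₀ ≥ 0` a bound `M` valid for EVERY nonnegative differentiable `y` on `[0,T]` with `y(0) = y₀` and
`y′ ≤ a + b·y + c·y²`.  Grönwall's lemma does not cover the quadratic term: with `a = b = 0`, `c = 1`,
`T = 2`, `y₀ = 1` the Riccati comparison family `y_η(t) = 1/(1 − κt)`, `κ = (1−η)/2`, `η ∈ (0,1)`,
satisfies `y_η(0) = 1`, `y_η ≥ 0`, `y_η′ = κ·y_η² ≤ y_η²` on `[0,2]` and `y_η(2) = 1/η` — no uniform `M`
(witness `η = 1/(|M|+2)`).  OFF the composition path; the verdict locator of record `Step_C1a`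
(`not_Step_C1a`, `SoloRefutePanPan2025.lean`) is the adjacent interpolation step and is untouched, as are
token #103 / class / totals.  Refuter: ns-claims-refuter-1 g4; filed under convention (b) by a salvage
prover.

WHAT THIS IS NOT: not a claim about NS regularity or blow-up; not a claim about any author beyond the
typed locator.
-/

set_option linter.dupNamespace false

namespace Summit.NavierStokesRegularity.NavierStokesRegularity.Theorems.PanPan2025

open Literature.Claims.NS.PanPan2025 Set

/-- **The Grönwall step p.28 l.1–4 fails at the printed grain** (quadratic right-hand side): Riccati family
`y_η(t) = 1/(1 − (1−η)t/2)` at `a = b = 0`, `c = 1`, `T = 2`, `y₀ = 1`.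
[cite: PanPan2025, Ch. Ⅲ §3.1.2 p.27 d11 – p.28 l.4] -/
theorem not_Step_C1bAbs : ¬ Step_C1bAbs := by
  intro h
  obtain ⟨M, hM⟩ := h 0 0 1 le_rfl le_rfl zero_le_one 2 two_pos 1 zero_le_one
  -- the Riccati comparison solution with blow-up time just beyond T = 2
  set η : ℝ := 1 / (|M| + 2) with hη
  have hη0 : 0 < η := by positivity
  have hη1 : η ≤ 1 / 2 := one_div_le_one_div_of_le two_pos (by linarith [abs_nonneg M])
  set κ : ℝ := (1 - η) / 2 with hκ
  have hκ0 : 0 ≤ κ := by rw [hκ]; linarith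
  have hκ1 : κ < 1 := by rw [hκ]; linarith
  have hκ2 : 1 - κ * 2 = η := by rw [hκ]; ring
  have hD : ∀ t ∈ Icc (0 : ℝ) 2, 0 < 1 - κ * t := by
    intro t ht
    have : κ * t ≤ κ * 2 := mul_le_mul_of_nonneg_left ht.2 hκ0
    linarith
  have hy0 : (fun t : ℝ => (1 - κ * t)⁻¹) 0 = 1 := by simp
  have hynn : ∀ t ∈ Icc (0 : ℝ) 2, 0 ≤ (fun t : ℝ => (1 - κ * t)⁻¹) t :=
    fun t ht => inv_nonneg.2 (hD t ht).le
  have hyder : ∀ t ∈ Icc (0 : ℝ) 2, ∃ y' : ℝ, HasDerivAt (fun t : ℝ => (1 - κ * t)⁻¹) y' t ∧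
      y' ≤ 0 + 0 * (fun t : ℝ => (1 - κ * t)⁻¹) t + 1 * (fun t : ℝ => (1 - κ * t)⁻¹) t ^ 2 := by
    intro t ht
    have hDt := hD t ht
    have h1 : HasDerivAt (fun s : ℝ => 1 - κ * s) (-κ) t := by
      simpa using ((hasDerivAt_id t).const_mul κ).const_sub 1
    have h2 : HasDerivAt (fun s : ℝ => (1 - κ * s)⁻¹) (-(-κ) / (1 - κ * t) ^ 2) t := h1.inv hDt.ne'
    refine ⟨κ / (1 - κ * t) ^ 2, h2.congr_deriv (by ring), ?_⟩
    · show κ / (1 - κ * t) ^ 2 ≤ 0 + 0 * (1 - κ * t)⁻¹ + 1 * ((1 - κ * t)⁻¹) ^ 2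
      rw [inv_pow, div_eq_mul_inv]
      have hI : 0 < ((1 - κ * t) ^ 2)⁻¹ := by positivity
      nlinarith [hI, hκ1]
  have key := hM (fun t : ℝ => (1 - κ * t)⁻¹) hy0 hynn hyder 2 ⟨by norm_num, le_rfl⟩
  -- but y(2) = 1/η = |M| + 2 > M
  have hy2 : (1 - κ * 2)⁻¹ = |M| + 2 := by
    rw [hκ2, hη, one_div, inv_inv]
  have key' : (1 - κ * 2)⁻¹ ≤ M := key
  rw [hy2] at key'
  linarith [le_abs_self M]

/-- FQN guard: the negated constant is the skeleton's decl. -/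
example : ¬ Literature.Claims.NS.PanPan2025.Step_C1bAbs := not_Step_C1bAbs

end Summit.NavierStokesRegularity.NavierStokesRegularity.Theorems.PanPan2025
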